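import Literature.Analysis.FluidPDE.EnergySpaceTorus
import Literature.Analysis.FluidPDE.StokesTorusCompletenessProofs
import HarnessLib

/-!
# ns.S33: convergence of the Galerkin truncations on the torus (proof), and `P_N = ` Fourier
# truncation on `H`

`Literature.Analysis.FluidPDE.EnergySpaceTorus` vendors under the inventory id **ns.S33**, as the
named fact `galerkin_convergence`, the convergence of the Galerkin projections on the flat torus:
for every `v` in the energy space `H = Torus.energySpace d` (the `L²` closure of the span of the
smooth divergence-free mean-zero fields `𝒱`), `P_N v → v` in `L²(T^d; ℝ^d)` as `N → ∞`, where
`P_N = Torus.galerkinProj N` is the orthogonal projection of `L²` onto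
`Torus.galerkinSpace N = span {cos(2πk·x) a, sin(2πk·x) a : 0 < |k| ≤ N, a = projPerp k i}`
(Constantin–Foias 1988, Ch. 4: the Stokes eigenfunctions `(w_j)` are an orthonormal basis of `H`,
(4.7); periodic case (4.33), (4.42); Ch. 7, (7.4): `P_m f = ∑_{j ≤ m} (w_j, f) w_j`). It is
literally the `StokesTorus` fact `Torus.tendsto_galerkinProj`, discharged in the sibling
`StokesTorusCompletenessProofs` (`Torus.tendsto_galerkinProj_holds`, by Parseval and duality);
this file records the **discharge `galerkin_convergence_holds`**.

It also proves the concrete form of Constantin–Foias (7.4) on the torus, which the tree did not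
yet connect to `Torus.galerkinProj`: **on `H` the Galerkin projection is the Fourier truncation**,
`P_N v = FunctionSpaces.Torus.fourierTruncate N v` as `L²` classes
(`Torus.galerkinProj_eq_toLp_fourierTruncate`; Robinson–Rodrigo–Sadowski 2016, §4.1 (4.1):
`P_n u = ∑_{|k| ≤ n} û_k e^{ik·x}` *is* the projection onto the first Stokes eigenfunctions), so
that the `L²` convergence `P_N v → v` is also the Parseval tail estimate of RRS 2016, Lemma 4.1
(`Torus.tendsto_toLp_fourierTruncate`, from
`FunctionSpaces.Torus.tendsto_eLpNorm_fourierTruncate_sub`).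

## Proof of `P_N v = ` truncation (`v ∈ H`)

* *The truncation lies in `galerkinSpace N`.* By the frame identity
  `Torus.sum_integral_inner_frameField_smul` (which runs on `v̂(0) = 0` and `k · v̂(k) = 0` for
  `v ∈ H`), `fourierTruncate N v = ∑_{0<|k|≤N} ∑_i ∑_c (v, g_{kic}) g_{kic}` pointwise, where the
  frame field `g_{kic} = Torus.frameField k i c` is the Galerkin generator
  `stokesMode k (projPerp k i) c` (`Torus.stokesMode_projPerp_apply`); `ContinuousMap.toLp` being
  linear, the `L²` class of the truncation is the same combination of the generators
  (`toLp_fourierTruncate_mem_galerkinSpace`).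
* *The truncation error is orthogonal to `galerkinSpace N`* (any `v ∈ L²`): its Fourier
  coefficients vanish on the ball `|k| ≤ N` (`FunctionSpaces.Torus.mFourierCoeff_fourierTruncate`),
  and the `L²` pairing with a generator of frequency `k` is `Re ⟪(v − T_N v)^(k), frameVec k i c⟫_ℂ`
  (`Torus.inner_toLp_realTrigPoly_singleton`, `Torus.stokesModeL2_projPerp_eq_toLp`).
* Hence `P_N v = T_N v` by the characterisation of the orthogonal projection (Mathlib's
  `Submodule.eq_starProjection_of_mem_of_inner_eq_zero`).

No new definitions and no new named facts.

## References

* P. Constantin, C. Foias, *Navier–Stokes Equations*, Univ. Chicago Press (1988), Ch. 4,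
  (4.4)–(4.7), (4.33), (4.42); Ch. 7, (7.4). [ConstantinFoias1988]
* J. C. Robinson, J. L. Rodrigo, W. Sadowski, *The Three-Dimensional Navier–Stokes Equations*,
  CUP (2016), §4.1, (4.1) and Lemma 4.1 (p. 74). [RobinsonRodrigoSadowski2016]
-/

noncomputable section

open MeasureTheory Filter UnitAddTorus
open scoped InnerProductSpace RealInnerProductSpace ENNReal Topology

namespace Literature.Analysis.FluidPDE

namespace Torus

variable {d : Type*} [Fintype d] [DecidableEq d]

/-! ## Frequencies -/

/-- The non-zero ball `freqBall₀ N = {0 < |k|² ≤ N²}` of `StatisticalSolutionEnergyEq` is contained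
in (indeed equal to) the Galerkin frequency set `galerkinIndex N`. [folklore] -/
theorem mem_galerkinIndex_of_mem_freqBall₀ {N : ℕ} {k : d → ℤ} (hk : k ∈ freqBall₀ (d := d) N) :
    k ∈ galerkinIndex (d := d) N := by
  rw [freqBall₀, Finset.mem_erase] at hk
  exact mem_galerkinIndex_iff'.2 ⟨FunctionSpaces.Torus.mem_freqBall.1 hk.2, hk.1⟩

/-- Conversely `galerkinIndex N ⊆ freqBall₀ N`. [folklore] -/
theorem mem_freqBall₀_of_mem_galerkinIndex {N : ℕ} {k : d → ℤ}
    (hk : k ∈ galerkinIndex (d := d) N) : k ∈ freqBall₀ (d := d) N := by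
  rw [mem_galerkinIndex_iff'] at hk
  rw [freqBall₀, Finset.mem_erase]
  exact ⟨hk.2, FunctionSpaces.Torus.mem_freqBall.2 hk.1⟩

/-! ## The Fourier truncation of `v ∈ H` lies in `galerkinSpace N` -/

/-- **The truncation of `v ∈ H` in the Galerkin frame**, as continuous maps:
`P_N v = ∑_{0<|k|≤N} ∑_i ∑_c (v, g_{kic}) • stokesMode k (projPerp k i) c`
(`Torus.sum_integral_inner_frameField_smul` and `Torus.stokesMode_projPerp_apply`;
Constantin–Foias 1988, Ch. 7, (7.4): `P_m f = ∑_j (w_j, f) w_j`).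
[cite: ConstantinFoias1988, Ch. 7 (7.4)] -/
theorem fourierTruncate_eq_sum_stokesMode
    {v : Lp (EuclideanSpace ℝ d) 2 (volume : Measure (UnitAddTorus d))}
    (hv : v ∈ FunctionSpaces.Torus.energySpace d) (N : ℕ) :
    (⟨FunctionSpaces.Torus.fourierTruncate N (v : UnitAddTorus d → EuclideanSpace ℝ d),
        FunctionSpaces.Torus.continuous_fourierTruncate N _⟩ :
        C(UnitAddTorus d, EuclideanSpace ℝ d)) =
      ∑ k ∈ freqBall₀ N, ∑ i, ∑ c,
        (∫ y, ⟪(v : UnitAddTorus d → EuclideanSpace ℝ d) y, frameField k i c y⟫_ℝ) •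
          stokesMode k (projPerp k i) c := by
  ext1 x
  rw [ContinuousMap.coe_mk, ← sum_integral_inner_frameField_smul hv N x]
  simp only [ContinuousMap.coe_sum, ContinuousMap.coe_smul, Finset.sum_apply, Pi.smul_apply,
    stokesMode_projPerp_apply]
  rfl

/-- **The `L²` class of the truncation of `v ∈ H` lies in `galerkinSpace N`**: it is a finite
linear combination of the generators `galerkinFamily N ⟨k, i, c⟩`, `0 < |k| ≤ N`
(`ContinuousMap.toLp` is linear; Constantin–Foias 1988, Ch. 7, (7.4): `P_m f ∈ span {w_j}`).
[cite: ConstantinFoias1988, Ch. 7 (7.4)] -/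
theorem toLp_fourierTruncate_mem_galerkinSpace
    {v : Lp (EuclideanSpace ℝ d) 2 (volume : Measure (UnitAddTorus d))}
    (hv : v ∈ FunctionSpaces.Torus.energySpace d) (N : ℕ) :
    ContinuousMap.toLp (E := EuclideanSpace ℝ d) 2 volume ℝ
        ⟨FunctionSpaces.Torus.fourierTruncate N (v : UnitAddTorus d → EuclideanSpace ℝ d),
          FunctionSpaces.Torus.continuous_fourierTruncate N _⟩ ∈
      galerkinSpace (d := d) N := by
  rw [fourierTruncate_eq_sum_stokesMode hv N, map_sum]
  refine Submodule.sum_mem _ fun k hk => ?_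
  rw [map_sum]
  refine Submodule.sum_mem _ fun i _ => ?_
  rw [map_sum]
  refine Submodule.sum_mem _ fun c _ => ?_
  rw [map_smul]
  exact Submodule.smul_mem _ _
    (Submodule.subset_span ⟨⟨⟨k, mem_galerkinIndex_of_mem_freqBall₀ hk⟩, i, c⟩, rfl⟩)

/-! ## The truncation error is orthogonal to `galerkinSpace N` -/

/-- The `L²` class of the truncation is represented by the truncation. [folklore] -/
theorem coeFn_toLp_fourierTruncate (N : ℕ)
    (v : Lp (EuclideanSpace ℝ d) 2 (volume : Measure (UnitAddTorus d))) :
    (ContinuousMap.toLp (E := EuclideanSpace ℝ d) 2 volume ℝ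
        ⟨FunctionSpaces.Torus.fourierTruncate N (v : UnitAddTorus d → EuclideanSpace ℝ d),
          FunctionSpaces.Torus.continuous_fourierTruncate N _⟩ :
        UnitAddTorus d → EuclideanSpace ℝ d) =ᵐ[volume]
      FunctionSpaces.Torus.fourierTruncate N (v : UnitAddTorus d → EuclideanSpace ℝ d) :=
  ContinuousMap.coeFn_toLp (E := EuclideanSpace ℝ d) volume _

/-- **The truncation error has no Fourier modes in the ball**: for `v ∈ L²(T^d; ℝ^d)` and
`|k| ≤ N`, `(v − T_N v)^(k) = v̂(k) − v̂(k) = 0`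
(`FunctionSpaces.Torus.mFourierCoeff_fourierTruncate`; Robinson–Rodrigo–Sadowski 2016, §4.1).
[cite: RobinsonRodrigoSadowski2016, §4.1 (4.1)] -/
theorem mFourierCoeff_sub_toLp_fourierTruncate_eq_zero
    (v : Lp (EuclideanSpace ℝ d) 2 (volume : Measure (UnitAddTorus d))) {N : ℕ} {k : d → ℤ}
    (hk : k ∈ FunctionSpaces.Torus.freqBall N) :
    mFourierCoeff (FunctionSpaces.EuclideanSpace.complexify ∘
      ((v - ContinuousMap.toLp (E := EuclideanSpace ℝ d) 2 volume ℝ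
          ⟨FunctionSpaces.Torus.fourierTruncate N (v : UnitAddTorus d → EuclideanSpace ℝ d),
            FunctionSpaces.Torus.continuous_fourierTruncate N _⟩ :
          Lp (EuclideanSpace ℝ d) 2 (volume : Measure (UnitAddTorus d))) :
        UnitAddTorus d → EuclideanSpace ℝ d)) k = 0 := by
  have hint : Integrable (v : UnitAddTorus d → EuclideanSpace ℝ d) volume :=
    (Lp.memLp v).integrable one_le_two
  rw [mFourierCoeff_complexify_coe_sub,
    FunctionSpaces.Torus.mFourierCoeff_congr_ae
      ((coeFn_toLp_fourierTruncate N v).fun_comp FunctionSpaces.EuclideanSpace.complexify) k,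
    FunctionSpaces.Torus.mFourierCoeff_fourierTruncate hint N k, if_pos hk, sub_self]

/-- **The truncation error is orthogonal to the Galerkin generators**: for `v ∈ L²(T^d; ℝ^d)`,
`⟪v − T_N v, g⟫_{L²} = 0` for every generator `g = stokesModeL2 k (projPerp k i) c` of
`galerkinSpace N` — the pairing with the single real mode of frequency `k`, `|k| ≤ N`, is
`Re ⟪(v − T_N v)^(k), frameVec k i c⟫_ℂ = 0` (`Torus.inner_toLp_realTrigPoly_singleton`;
Robinson–Rodrigo–Sadowski 2016, §4.1: `P_n` is the orthogonal projection onto the modes `≤ n`).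
[cite: RobinsonRodrigoSadowski2016, §4.1 (4.1)] -/
theorem inner_sub_toLp_fourierTruncate_galerkinFamily
    (v : Lp (EuclideanSpace ℝ d) 2 (volume : Measure (UnitAddTorus d))) (N : ℕ)
    (p : ↥(galerkinIndex (d := d) N) × d × Bool) :
    ⟪v - ContinuousMap.toLp (E := EuclideanSpace ℝ d) 2 volume ℝ
        ⟨FunctionSpaces.Torus.fourierTruncate N (v : UnitAddTorus d → EuclideanSpace ℝ d),
          FunctionSpaces.Torus.continuous_fourierTruncate N _⟩,
      galerkinFamily N p⟫_ℝ = 0 := by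
  obtain ⟨⟨k, hk⟩, i, c⟩ := p
  rw [galerkinFamily, stokesModeL2_projPerp_eq_toLp, inner_toLp_realTrigPoly_singleton,
    mFourierCoeff_sub_toLp_fourierTruncate_eq_zero v
      (Finset.mem_of_mem_erase (mem_freqBall₀_of_mem_galerkinIndex hk)),
    inner_zero_left, Complex.zero_re]

/-- The truncation error of `v ∈ L²` is orthogonal to the whole Galerkin space (linearity in the
second slot over the span of the generators). [folklore] -/
theorem inner_sub_toLp_fourierTruncate_eq_zero_of_mem
    (v : Lp (EuclideanSpace ℝ d) 2 (volume : Measure (UnitAddTorus d))) {N : ℕ}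
    {w : Lp (EuclideanSpace ℝ d) 2 (volume : Measure (UnitAddTorus d))}
    (hw : w ∈ galerkinSpace (d := d) N) :
    ⟪v - ContinuousMap.toLp (E := EuclideanSpace ℝ d) 2 volume ℝ
        ⟨FunctionSpaces.Torus.fourierTruncate N (v : UnitAddTorus d → EuclideanSpace ℝ d),
          FunctionSpaces.Torus.continuous_fourierTruncate N _⟩, w⟫_ℝ = 0 := by
  induction hw using Submodule.span_induction with
  | mem w hw =>
    obtain ⟨p, rfl⟩ := hw
    exact inner_sub_toLp_fourierTruncate_galerkinFamily v N p
  | zero => exact inner_zero_right _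
  | add w z _ _ hw hz => rw [inner_add_right, hw, hz, add_zero]
  | smul r w _ hw => rw [real_inner_smul_right, hw, mul_zero]

/-! ## `P_N v` is the Fourier truncation on `H`; convergence -/

/-- **On `H` the Galerkin projection is the Fourier truncation** (Constantin–Foias 1988, Ch. 7,
(7.4): `P_m f = ∑_{j ≤ m} (w_j, f) w_j`; Robinson–Rodrigo–Sadowski 2016, §4.1 (4.1)): for
`v ∈ H = Torus.energySpace d`, `Torus.galerkinProj N v` is the `L²` class of
`FunctionSpaces.Torus.fourierTruncate N v = Re ∑_{|k| ≤ N} v̂(k) e_k` — the truncation lies in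
`galerkinSpace N` (`toLp_fourierTruncate_mem_galerkinSpace`, this uses `v ∈ H`) and the error is
orthogonal to it (`inner_sub_toLp_fourierTruncate_eq_zero_of_mem`), which characterises the
orthogonal projection (Mathlib's `Submodule.eq_starProjection_of_mem_of_inner_eq_zero`).
[cite: ConstantinFoias1988, Ch. 7 (7.4)] -/
theorem galerkinProj_eq_toLp_fourierTruncate
    {v : Lp (EuclideanSpace ℝ d) 2 (volume : Measure (UnitAddTorus d))}
    (hv : v ∈ FunctionSpaces.Torus.energySpace d) (N : ℕ) :
    galerkinProj (d := d) N v =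
      ContinuousMap.toLp (E := EuclideanSpace ℝ d) 2 volume ℝ
        ⟨FunctionSpaces.Torus.fourierTruncate N (v : UnitAddTorus d → EuclideanSpace ℝ d),
          FunctionSpaces.Torus.continuous_fourierTruncate N _⟩ :=
  Submodule.eq_starProjection_of_mem_of_inner_eq_zero (toLp_fourierTruncate_mem_galerkinSpace hv N)
    fun _ hw => inner_sub_toLp_fourierTruncate_eq_zero_of_mem v hw

/-- A.e. form: for `v ∈ H`, `P_N v = fourierTruncate N v` almost everywhere
(Constantin–Foias 1988, Ch. 7, (7.4)). [cite: ConstantinFoias1988, Ch. 7 (7.4)] -/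
theorem coeFn_galerkinProj_of_mem
    {v : Lp (EuclideanSpace ℝ d) 2 (volume : Measure (UnitAddTorus d))}
    (hv : v ∈ FunctionSpaces.Torus.energySpace d) (N : ℕ) :
    (galerkinProj (d := d) N v : UnitAddTorus d → EuclideanSpace ℝ d) =ᵐ[volume]
      FunctionSpaces.Torus.fourierTruncate N (v : UnitAddTorus d → EuclideanSpace ℝ d) := by
  rw [galerkinProj_eq_toLp_fourierTruncate hv N]
  exact coeFn_toLp_fourierTruncate N v

/-- **`T_N v → v` in `L²` for the Fourier truncation of any `v ∈ L²(T^d; ℝ^d)`**, at the level of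
`L²` classes (the Parseval tail; Robinson–Rodrigo–Sadowski 2016, Lemma 4.1, p. 74, proved in the
tree as `FunctionSpaces.Torus.tendsto_eLpNorm_fourierTruncate_sub`).
[cite: RobinsonRodrigoSadowski2016, Lemma 4.1, p. 74] -/
theorem tendsto_toLp_fourierTruncate
    (v : Lp (EuclideanSpace ℝ d) 2 (volume : Measure (UnitAddTorus d))) :
    Tendsto (fun N => ContinuousMap.toLp (E := EuclideanSpace ℝ d) 2 volume ℝ
        ⟨FunctionSpaces.Torus.fourierTruncate N (v : UnitAddTorus d → EuclideanSpace ℝ d),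
          FunctionSpaces.Torus.continuous_fourierTruncate N _⟩) atTop (𝓝 v) := by
  rw [tendsto_iff_norm_sub_tendsto_zero]
  have h := FunctionSpaces.Torus.tendsto_eLpNorm_fourierTruncate_sub (Lp.memLp v)
  have h' : Tendsto (fun N => (eLpNorm (FunctionSpaces.Torus.fourierTruncate N
      (v : UnitAddTorus d → EuclideanSpace ℝ d) - (v : UnitAddTorus d → EuclideanSpace ℝ d))
        2 volume).toReal) atTop (𝓝 0) := by
    have := (ENNReal.tendsto_toReal ENNReal.zero_ne_top).comp h
    rwa [ENNReal.toReal_zero] at this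
  refine h'.congr fun N => ?_
  rw [Lp.norm_def]
  congr 1
  refine eLpNorm_congr_ae ?_
  filter_upwards [Lp.coeFn_sub (ContinuousMap.toLp (E := EuclideanSpace ℝ d) 2 volume ℝ
      ⟨FunctionSpaces.Torus.fourierTruncate N (v : UnitAddTorus d → EuclideanSpace ℝ d),
        FunctionSpaces.Torus.continuous_fourierTruncate N _⟩) v,
    coeFn_toLp_fourierTruncate N v] with x hx h1
  rw [hx, Pi.sub_apply, Pi.sub_apply, h1]

/-- **`P_N v → v` on `H`, second proof**: by `galerkinProj_eq_toLp_fourierTruncate` the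
convergence of the Galerkin projections is the Parseval tail `‖T_N v − v‖_{L²} → 0`
(Robinson–Rodrigo–Sadowski 2016, Lemma 4.1); the tree's primary discharge is
`Torus.tendsto_galerkinProj_holds` of `StokesTorusCompletenessProofs`.
[cite: RobinsonRodrigoSadowski2016, Lemma 4.1, p. 74] -/
theorem tendsto_galerkinProj_of_mem
    {v : Lp (EuclideanSpace ℝ d) 2 (volume : Measure (UnitAddTorus d))}
    (hv : v ∈ FunctionSpaces.Torus.energySpace d) :
    Tendsto (fun N => galerkinProj (d := d) N v) atTop (𝓝 v) := by
  simp only [galerkinProj_eq_toLp_fourierTruncate hv]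
  exact tendsto_toLp_fourierTruncate v

end Torus

section NS

variable {d : Type*} [Fintype d] [DecidableEq d]

/-- **ns.S33, convergence of the Galerkin truncations** (discharge of the named fact
`galerkin_convergence`): for every `v ∈ H = Torus.energySpace d`, the Galerkin projections
`P_N v = Torus.galerkinProj N v` converge to `v` in `L²(T^d; ℝ^d)` as `N → ∞`. This is the
`StokesTorus` fact `Torus.tendsto_galerkinProj`, discharged as `Torus.tendsto_galerkinProj_holds`
(Constantin–Foias 1988, Ch. 4, (4.7) with (4.33), (4.42): the Stokes eigenfields form an
orthonormal basis of `H`; Ch. 7, (7.4): `P_m`). The vendored locator "(4.14)" of the fact is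
not the printed numbering (printed (4.13)–(4.14) are scaled Sobolev norms); the statement is
proved exactly as vendored. [cite: ConstantinFoias1988, Ch. 4 (4.7), (4.33), (4.42); Ch. 7 (7.4)] -/
theorem galerkin_convergence_holds : galerkin_convergence (d := d) :=
  fun _ hv => Torus.tendsto_galerkinProj_holds hv

end NS

end Literature.Analysis.FluidPDE
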